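import Literature.Analysis.FluidPDE.TaoForcedUniquenessEnstrophyLocalisation
import Literature.Analysis.FluidPDE.VorticityBlowupMaximal
import HarnessLib

/-!
# Tao (2011/2013), Cor. 11.1 (bounded enstrophy) WITH FORCE, a priori form: a finite energy
# classical solution of the FORCED system with finite dissipation, finite total speed, `H¹` datum
# and `‖∇ × f‖_{L¹_t L²_x} < ∞` lies in `X¹([0,T] × ℝ³)`

Cell `pub/ns-blowup`, seat `ns-blowup-lean2` (PATH A of the E–C route's Literature leaf W14 =
`tao2011_forced_unconditionalUniqueness_velocity`, Tao 2011 Cor. 11.4 = arXiv Cor. 71 WITH force).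
WHAT THIS IS NOT: not a statement about Navier–Stokes blow-up — regularity bookkeeping WITH force,
the forced twin of the tree's proof of Cor. 11.1 for `f = 0` (`tao2011_boundedEnstrophy_of_parts`,
`TaoEnstrophyLocalisation.lean`).

Printed (T. Tao, arXiv:1108.1165, Cor. 68, p. 36): "Let `(u,p,u₀,f,T)` be an almost smooth, finite
energy solution, such that the initial data `(u₀,f,T)` has finite `H¹` norm. Then
`u ∈ X¹([0,T] × ℝ³)`." Printed proof: "`‖ω₀‖_{L²} + ‖∇ × f‖_{L¹_tL²_x} < ∞`. By the monotone
convergence theorem, we thus have for `R` sufficiently large that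
`‖ω₀‖_{L²(ℝ³∖B(0,R))} + ‖∇ × f‖_{L¹_tL²_x([0,T] × (ℝ³∖B(0,R)))} ≤ δ`. Applying Theorem 10.1
(inverted as in Remark 10.6) … Gluing … from Lemma 8.1 one has `u ∈ L^∞_tL²_x ∩ L²_tH¹_x` …
Fourier analysis." This file proves that statement in A PRIORI form (the two global inputs of the
§10 argument — Lemma 8.1 = finite dissipation and Prop. 9.1 = finite total speed — are
hypotheses, as in the tree's a priori `f = 0` leaves), at unit viscosity and then for every
`ν > 0` by Tao's rescaling (footnote 3):

* `exists_forceBudget_compl_ball_le` — the monotone-convergence choice of `R` for the force budget;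
* `memSobolevX_one_forced_unit_of_apriori` — Cor. 11.1 WITH force, a priori, `ν = 1`;
* `memSobolevX_one_forced_of_apriori` — the same for every viscosity `ν > 0`.

The hypotheses `tao2011_nonlinearEstimate` (the `Y₆` estimate) and `tao2011_sobolev_of_vorticity`
(the Fourier step) are THEOREMS of the tree (`tao2011_nonlinearEstimate_holds`,
`tao2011_sobolev_of_vorticity_holds`); they are kept as hypotheses here, as in the `f = 0` assembly,
to keep the import closure light, and are discharged where the result is consumed. Everything is
proved; no definition and no named fact is introduced (D-0026).

## Mathlib / tree search

Tree: `tao2011_boundedEnstrophy_of_parts` (`f = 0`), `exists_setLIntegral_compl_ball_le`,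
`setLIntegral_ball_enorm_sq_le`, `lintegral_curl_sq_le` (`TaoEnstrophyLocalisation`),
`IsSmoothSpaceTimeOn.continuousOn_curl` (`VorticityBlowupMaximal`), the rescaling bookkeeping of
`TaoUnitViscosity`/`NSViscosityRescaling` (`IsClassicalNSSolutionOn.viscosityRescale`, with force).
Mathlib: `tendsto_measure_iInter_atTop`, `tendsto_lintegral_of_dominated_convergence'`,
`ae_lt_top'`, `Measurable.lintegral_prod_right'`.

## References

* T. Tao, *Localisation and compactness properties of the Navier–Stokes global regularity
  problem*, Anal. PDE 6 (2013) 25–107 = arXiv:1108.1165 (`Tao2011`): Cor. 11.1 (arXiv Cor. 68,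
  p. 36) and its proof; Thm. 10.1 + Remark 10.6; footnote 3 (rescaling).
-/

noncomputable section

open MeasureTheory Set Function Filter intervalIntegral Topology
open scoped ENNReal NNReal RealInnerProductSpace ContDiff

namespace Literature.Analysis.FluidPDE

/-! ## The tail of the force budget `‖∇ × f‖_{L¹_t L²_x(ℝ³ ∖ B(0,R))}` -/

section ForceTail

variable {T : ℝ} {f : ℝ → EuclideanSpace ℝ (Fin 3) → EuclideanSpace ℝ (Fin 3)}

/-- The curl of a force smooth on the closed slab, with the time variable clamped to `[0, T]`, is
jointly continuous on `ℝ × ℝ³` (measurability plumbing). [folklore] -/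
private theorem continuous_curl_force_clamp (hT : 0 < T) (hf : FluidPDE.IsSmoothSpaceTimeOn (Icc 0 T) f) :
    Continuous fun z : ℝ × EuclideanSpace ℝ (Fin 3) => FluidPDE.curl (f (max 0 (min T z.1))) z.2 := by
  have hcont := hf.continuousOn_curl (uniqueDiffOn_Icc hT)
  have hπc : Continuous fun t : ℝ => max 0 (min T t) :=
    continuous_const.max (continuous_const.min continuous_id)
  have hπmem : ∀ t : ℝ, max 0 (min T t) ∈ Icc 0 T := fun t =>
    ⟨le_max_left _ _, max_le hT.le (min_le_left _ _)⟩
  have hmap : Continuous fun z : ℝ × EuclideanSpace ℝ (Fin 3) =>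
      ((max 0 (min T z.1), z.2) : ℝ × EuclideanSpace ℝ (Fin 3)) :=
    (hπc.comp continuous_fst).prodMk continuous_snd
  exact hcont.comp_continuous hmap fun z => mk_mem_prod (hπmem z.1) (mem_univ _)

/-- For a force smooth on the closed slab `[0, T] × ℝ³` and any set `S ⊆ ℝ³`, the local force rate
`t ↦ ‖∇ × f(t)‖_{L²(S)} = (∫_S |∇ × f(t)|²)^{1/2}` is a.e.-measurable on `(0, T)` (clamp the time
variable, Tonelli, and agree on `(0, T)`). [folklore] -/
private theorem aemeasurable_forceTail (hT : 0 < T) (hf : FluidPDE.IsSmoothSpaceTimeOn (Icc 0 T) f)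
    (S : Set (EuclideanSpace ℝ (Fin 3))) :
    AEMeasurable (fun t => (∫⁻ x in S, ‖FluidPDE.curl (f t) x‖ₑ ^ 2) ^ (1 / 2 : ℝ))
      (volume.restrict (Ioo 0 T)) := by
  have hHc := continuous_curl_force_clamp hT hf
  have hπid : ∀ t ∈ Icc 0 T, max 0 (min T t) = t := fun t ht => by
    rw [min_eq_right ht.2, max_eq_right ht.1]
  have hmeas : Measurable fun z : ℝ × EuclideanSpace ℝ (Fin 3) =>
      ‖FluidPDE.curl (f (max 0 (min T z.1))) z.2‖ₑ ^ 2 :=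
    hHc.enorm.measurable.pow_const 2
  have hF : Measurable fun t : ℝ =>
      (∫⁻ x in S, ‖FluidPDE.curl (f (max 0 (min T t))) x‖ₑ ^ 2) ^ (1 / 2 : ℝ) :=
    ENNReal.continuous_rpow_const.measurable.comp hmeas.lintegral_prod_right'
  refine hF.aemeasurable.congr ?_
  refine (ae_restrict_mem measurableSet_Ioo).mono fun t ht => ?_
  simp only [hπid t (Ioo_subset_Icc_self ht)]

/-- Continuity from above along the exteriors of the balls `B(0, n)`: if `∫ φ < ∞` then
`∫_{ℝ³ ∖ B(0,n)} φ → 0`. [folklore] -/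
private theorem tendsto_setLIntegral_compl_ball {φ : EuclideanSpace ℝ (Fin 3) → ℝ≥0∞}
    (hφ : ∫⁻ x, φ x < ⊤) :
    Tendsto (fun n : ℕ => ∫⁻ x in (Metric.ball (0 : EuclideanSpace ℝ (Fin 3)) n)ᶜ, φ x) atTop (𝓝 0) := by
  set μ' : Measure (EuclideanSpace ℝ (Fin 3)) := volume.withDensity φ with hμ'
  set s : ℕ → Set (EuclideanSpace ℝ (Fin 3)) := fun n => (Metric.ball (0 : EuclideanSpace ℝ (Fin 3)) n)ᶜ
    with hs
  have hsm : ∀ n, NullMeasurableSet (s n) μ' := fun n =>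
    (measurableSet_ball.compl).nullMeasurableSet
  have hanti : Antitone s := by
    intro n m hnm
    exact compl_subset_compl.2 (Metric.ball_subset_ball (by exact_mod_cast hnm))
  have hfin : ∃ n, μ' (s n) ≠ ⊤ := by
    refine ⟨0, ne_top_of_le_ne_top hφ.ne ?_⟩
    rw [hμ', withDensity_apply _ (measurableSet_ball.compl)]
    exact setLIntegral_le_lintegral _ _
  have hlim := tendsto_measure_iInter_atTop hsm hanti hfin
  have hempty : (⋂ n, s n) = ∅ := by
    simp only [hs, ← compl_iUnion, Metric.iUnion_ball_nat, compl_univ]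
  rw [hempty, measure_empty] at hlim
  refine hlim.congr fun n => ?_
  show μ' (s n) = _
  rw [hμ', withDensity_apply _ (measurableSet_ball.compl)]

/-- **"By the monotone convergence theorem, we thus have for `R` sufficiently large that
`‖∇ × f‖_{L¹_t L²_x([0,T] × (ℝ³ ∖ B(0,R)))} ≤ δ`"** (Tao 2011, proof of Cor. 11.1, arXiv p. 36):
if the force budget `∫₀ᵀ ‖∇ × f(t)‖_{L²(ℝ³)} dt` is finite then for every `ε > 0` and every `ρ`
there is `R > ρ` with `∫₀ᵀ ‖∇ × f(t)‖_{L²(ℝ³ ∖ B(0,R))} dt ≤ ε` (dominated convergence in `t`,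
continuity from above in `x`). [cite: Tao2011, Cor. 11.1 (arXiv Cor. 68), proof] -/
theorem exists_forceBudget_compl_ball_le (hT : 0 < T) (hf : FluidPDE.IsSmoothSpaceTimeOn (Icc 0 T) f)
    (hcf : ∫⁻ t in Ioo 0 T, (∫⁻ x, ‖FluidPDE.curl (f t) x‖ₑ ^ 2) ^ (1 / 2 : ℝ) < ⊤)
    {ε : ℝ≥0∞} (hε : 0 < ε) (ρ : ℝ) :
    ∃ R : ℝ, ρ < R ∧ ∫⁻ t in Ioo 0 T, (∫⁻ x in (Metric.ball (0 : EuclideanSpace ℝ (Fin 3)) R)ᶜ,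
      ‖FluidPDE.curl (f t) x‖ₑ ^ 2) ^ (1 / 2 : ℝ) ≤ ε := by
  set G : ℝ → ℝ≥0∞ := fun t => (∫⁻ x, ‖FluidPDE.curl (f t) x‖ₑ ^ 2) ^ (1 / 2 : ℝ) with hGdef
  set F : ℕ → ℝ → ℝ≥0∞ := fun n t => (∫⁻ x in (Metric.ball (0 : EuclideanSpace ℝ (Fin 3)) n)ᶜ,
      ‖FluidPDE.curl (f t) x‖ₑ ^ 2) ^ (1 / 2 : ℝ) with hFdef
  have hGm : AEMeasurable G (volume.restrict (Ioo 0 T)) := by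
    have h := aemeasurable_forceTail hT hf (univ : Set (EuclideanSpace ℝ (Fin 3)))
    simpa only [Measure.restrict_univ] using h
  have hFm : ∀ n, AEMeasurable (F n) (volume.restrict (Ioo 0 T)) := fun n =>
    aemeasurable_forceTail hT hf _
  have hbound : ∀ n, ∀ᵐ t ∂(volume.restrict (Ioo 0 T)), F n t ≤ G t := fun n =>
    ae_of_all _ fun t => ENNReal.rpow_le_rpow (setLIntegral_le_lintegral _ _) (by norm_num)
  have hGfin : ∀ᵐ t ∂(volume.restrict (Ioo 0 T)), G t < ⊤ := ae_lt_top' hGm hcf.ne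
  have hlim : ∀ᵐ t ∂(volume.restrict (Ioo 0 T)), Tendsto (fun n => F n t) atTop (𝓝 0) := by
    filter_upwards [hGfin] with t ht
    have hφ : ∫⁻ x, ‖FluidPDE.curl (f t) x‖ₑ ^ 2 < ⊤ := by
      by_contra h
      rw [not_lt, top_le_iff] at h
      rw [hGdef] at ht
      simp only [h, ENNReal.top_rpow_of_pos (by norm_num : (0 : ℝ) < 1 / 2), lt_self_iff_false] at ht
    have h1 := tendsto_setLIntegral_compl_ball hφ
    have h2 : Tendsto (fun z : ℝ≥0∞ => z ^ (1 / 2 : ℝ)) (𝓝 0) (𝓝 ((0 : ℝ≥0∞) ^ (1 / 2 : ℝ))) :=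
      ENNReal.continuous_rpow_const.tendsto 0
    rw [ENNReal.zero_rpow_of_pos (by norm_num : (0 : ℝ) < 1 / 2)] at h2
    exact h2.comp h1
  have hconv := tendsto_lintegral_of_dominated_convergence' G hFm hbound hcf.ne hlim
  rw [lintegral_zero] at hconv
  have hev : ∀ᶠ n : ℕ in atTop, ∫⁻ t in Ioo 0 T, F n t < ε := (tendsto_order.1 hconv).2 ε hε
  obtain ⟨n, hn, hn'⟩ := (hev.and (eventually_gt_atTop ⌈ρ⌉₊)).exists
  refine ⟨n, (Nat.le_ceil ρ).trans_lt (by exact_mod_cast hn'), hn.le⟩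

end ForceTail

/-! ## Cor. 11.1 WITH FORCE, a priori form, unit viscosity -/

section BoundedEnstrophyUnit

/-- **Tao 2011, Cor. 11.1 (Bounded enstrophy, arXiv Cor. 68) WITH FORCE — a priori form, unit
viscosity.** Printed (p. 36): "Let `(u,p,u₀,f,T)` be an almost smooth, finite energy solution, such
that the initial data `(u₀,f,T)` has finite `H¹` norm. Then `u ∈ X¹([0,T] × ℝ³)`." Here for a
classical solution of the FORCED `ν = 1` system on the closed slab `[0,T] × ℝ³` with finite energy
`sup_t ∫|u|² < ∞`, and with the two global inputs of the printed proof made hypotheses — Lemma 8.1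
as finite dissipation `∫₀ᵀ∫|∇u|² < ∞` and Prop. 9.1 as finite total speed `∫₀ᵀ‖u‖_{L^∞} < ∞` —
an `H¹` datum `∫|∇u(0)|² < ∞` and a force with `‖∇ × f‖_{L¹_t L²_x([0,T] × ℝ³)} < ∞` (finite `H¹`
norm of the data) give `u ∈ X¹([0,T] × ℝ³)` (`MemSobolevX 1 T u`). The printed proof: `δ` small
((10.2)), `r > C(E + M + δ⁻²)`, `R` with `‖ω₀‖_{L²(ℝ³∖B(0,R))} + ‖∇ × f‖_{L¹_tL²_x(ℝ³∖B(0,R))} ≤ δ`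
(monotone convergence: `exists_setLIntegral_compl_ball_le`, `exists_forceBudget_compl_ball_le`),
Thm. 10.1 inverted WITH force (`enstrophyLocalisation_exterior_apriori_unit_forced`), interior
bounds from joint smoothness, gluing, and the Fourier step `tao2011_sobolev_of_vorticity` (a
theorem of the tree, kept as a hypothesis as in the `f = 0` assembly
`tao2011_boundedEnstrophy_of_parts`, whose proof this one follows line by line).
[cite: Tao2011, Cor. 11.1 (arXiv Cor. 68, p. 36), proof] -/
theorem memSobolevX_one_forced_unit_of_apriori (hY : tao2011_nonlinearEstimate)
    (hB : tao2011_sobolev_of_vorticity) {T : ℝ} (hT : 0 < T)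
    {f u : ℝ → EuclideanSpace ℝ (Fin 3) → EuclideanSpace ℝ (Fin 3)}
    {p : ℝ → EuclideanSpace ℝ (Fin 3) → ℝ} (hsol : FluidPDE.IsClassicalNSSolutionOn (Icc 0 T) 1 f u p)
    (hfe : ∃ A : ℝ≥0∞, A < ⊤ ∧ ∀ t ∈ Icc 0 T, ∫⁻ x, ‖u t x‖ₑ ^ 2 ≤ A)
    (hD : ∫⁻ t in Ioo 0 T, ∫⁻ x, ENNReal.ofReal (FluidPDE.frobeniusNormSq (fderiv ℝ (u t) x)) < ⊤)
    (hMt : ∫⁻ t in Ioo 0 T, eLpNorm (u t) ∞ volume < ⊤)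
    (h₀ : ∫⁻ x, ‖iteratedFDeriv ℝ 1 (u 0) x‖ₑ ^ 2 < ⊤)
    (hcf : ∫⁻ t in Ioo 0 T, (∫⁻ x, ‖FluidPDE.curl (f t) x‖ₑ ^ 2) ^ (1 / 2 : ℝ) < ⊤) :
    MemSobolevX 1 T u := by
  obtain ⟨A₀, hA₀top, hA₀⟩ := hfe
  obtain ⟨K, hK⟩ := hB
  obtain ⟨c, C, A, hc, hC, hApos, hmain⟩ := enstrophyLocalisation_exterior_apriori_unit_forced hY
  have hsm : FluidPDE.IsSmoothSpaceTimeOn (Icc 0 T) u := hsol.smooth_velocity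
  have hfsm : FluidPDE.IsSmoothSpaceTimeOn (Icc 0 T) f :=
    hsol.isSmoothSpaceTimeOn_force (uniqueDiffOn_Icc hT)
  have hUD : UniqueDiffOn ℝ (Icc 0 T) := uniqueDiffOn_Icc hT
  have hu : ∀ t ∈ Icc 0 T, ContDiff ℝ ∞ (u t) := fun t ht => hsol.contDiff_velocity ht
  have hL2 : ∀ t ∈ Icc 0 T, ∫⁻ x, ‖u t x‖ₑ ^ 2 < ⊤ := fun t ht =>
    (hA₀ t ht).trans_lt hA₀top
  -- the energy `E` and the total speed `M`
  set D : ℝ≥0∞ := ∫⁻ t in Ioo 0 T, ∫⁻ x, ENNReal.ofReal (FluidPDE.frobeniusNormSq (fderiv ℝ (u t) x))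
    with hDdef
  set E : ℝ := A₀.toReal / 2 + D.toReal with hEdef
  have hE0 : 0 ≤ E := by positivity
  have hEt : ∀ t ∈ Icc 0 T, ∫⁻ x, ‖u t x‖ₑ ^ 2 ≤ ENNReal.ofReal (2 * E) := fun t ht => by
    refine (hA₀ t ht).trans ?_
    rw [← ENNReal.ofReal_toReal hA₀top.ne]
    refine ENNReal.ofReal_le_ofReal ?_
    rw [hEdef]
    have : 0 ≤ D.toReal := ENNReal.toReal_nonneg
    linarith
  have hD' : ENNReal.ofReal 1 * D ≤ ENNReal.ofReal E := by
    rw [ENNReal.ofReal_one, one_mul, ← ENNReal.ofReal_toReal hD.ne]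
    refine ENNReal.ofReal_le_ofReal ?_
    rw [hEdef]
    have : 0 ≤ A₀.toReal / 2 := by positivity
    linarith
  set M : ℝ := (∫⁻ t in Ioo 0 T, eLpNorm (u t) ∞ volume).toReal with hMdef
  have hM0 : 0 ≤ M := ENNReal.toReal_nonneg
  have hMt' : ∫⁻ t in Ioo 0 T, eLpNorm (u t) ∞ volume ≤ ENNReal.ofReal M := by
    rw [hMdef, ENNReal.ofReal_toReal hMt.ne]
  -- the choice of `δ` (condition (10.2))
  set δ : ℝ := min 1 (c / (T * (1 + Real.sqrt E))) with hδdef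
  have hden : 0 < T * (1 + Real.sqrt E) := by positivity
  have hδpos : 0 < δ := lt_min one_pos (div_pos hc hden)
  have hδ1 : δ ≤ 1 := min_le_left _ _
  have hsmall : δ ^ 4 * T + δ ^ 5 * Real.sqrt E * T ≤ c := by
    have h4 : δ ^ 4 ≤ δ := pow_le_of_le_one hδpos.le hδ1 (by norm_num)
    have h5 : δ ^ 5 ≤ δ := pow_le_of_le_one hδpos.le hδ1 (by norm_num)
    have hsq : 0 ≤ Real.sqrt E := Real.sqrt_nonneg _
    calc δ ^ 4 * T + δ ^ 5 * Real.sqrt E * T ≤ δ * T + δ * Real.sqrt E * T := by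
          gcongr
      _ = δ * (T * (1 + Real.sqrt E)) := by ring
      _ ≤ c / (T * (1 + Real.sqrt E)) * (T * (1 + Real.sqrt E)) := by
          gcongr; exact min_le_right _ _
      _ = c := div_mul_cancel₀ _ hden.ne'
  -- the choice of `r` (condition (10.3), a priori form)
  set r : ℝ := C * (E + M + δ⁻¹ ^ 2) + 1 with hrdef
  have hlarge : C * (E + M + δ⁻¹ ^ 2) < r := lt_add_one _
  have hrpos : 0 < r := by
    have : 0 ≤ C * (E + M + δ⁻¹ ^ 2) := by positivity
    linarith
  -- the choice of `R`: small exterior initial enstrophy AND small exterior force budget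
  have hcurl0 : ∫⁻ x, ‖FluidPDE.curl (u 0) x‖ₑ ^ 2 < ⊤ :=
    (lintegral_curl_sq_le (u 0)).trans_lt (ENNReal.mul_lt_top ENNReal.ofReal_lt_top h₀)
  have hδ2 : (0 : ℝ≥0∞) < ENNReal.ofReal (δ ^ 2) := ENNReal.ofReal_pos.2 (by positivity)
  have hδ1' : (0 : ℝ≥0∞) < ENNReal.ofReal δ := ENNReal.ofReal_pos.2 hδpos
  obtain ⟨R₁, hR₁2r, hω₀R₁⟩ := exists_setLIntegral_compl_ball_le hcurl0 hδ2 (2 * r)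
  obtain ⟨R, hR₁R, hFR⟩ := exists_forceBudget_compl_ball_le hT hfsm hcf hδ1' R₁
  have hR2r : 2 * r < R := hR₁2r.trans hR₁R
  have hrR : r < R / 2 := by linarith
  have hω₀ : ∫⁻ x in (Metric.ball (0 : EuclideanSpace ℝ (Fin 3)) R)ᶜ, ‖FluidPDE.curl (u 0) x‖ₑ ^ 2 ≤
      ENNReal.ofReal (δ ^ 2) :=
    (lintegral_mono_set (compl_subset_compl.2 (Metric.ball_subset_ball hR₁R.le))).trans hω₀R₁
  -- Theorem 10.1 WITH force, inverted
  obtain ⟨hext1, hext2⟩ :=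
    hmain hT hsol hE0 hM0 hEt hD' hMt' 0 hδpos hrpos hrR hω₀ hFR hsmall hlarge
  -- interior bounds from joint smoothness on `[0,T] × B̄(0, R + r)`
  set ρ : ℝ := R + r with hρ
  obtain ⟨M₁, hM₁⟩ := hsm.exists_bound_iteratedFDeriv isCompact_Icc hUD
    (isCompact_closedBall (0 : EuclideanSpace ℝ (Fin 3)) ρ) 1
  obtain ⟨M₂, hM₂⟩ := hsm.exists_bound_iteratedFDeriv isCompact_Icc hUD
    (isCompact_closedBall (0 : EuclideanSpace ℝ (Fin 3)) ρ) 2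
  set κ : ℝ := ‖FluidPDE.curlCLM‖ with hκ
  have hκ0 : 0 ≤ κ := by rw [hκ]; exact norm_nonneg FluidPDE.curlCLM
  have hcurl_pt : ∀ t ∈ Icc 0 T, ∀ x ∈ Metric.closedBall (0 : EuclideanSpace ℝ (Fin 3)) ρ,
      ‖FluidPDE.curl (u t) x‖ ≤ κ * M₁ := by
    intro t ht x hx
    refine (FluidPDE.norm_curl_le (u t) x).trans ?_
    rw [← norm_iteratedFDeriv_one]
    exact mul_le_mul_of_nonneg_left (hM₁ t ht x hx) hκ0
  have hdcurl_pt : ∀ t ∈ Icc 0 T, ∀ x ∈ Metric.closedBall (0 : EuclideanSpace ℝ (Fin 3)) ρ,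
      ‖fderiv ℝ (FluidPDE.curl (u t)) x‖ ≤ κ * M₂ := by
    intro t ht x hx
    refine (FluidPDE.norm_fderiv_curl_le ((hu t ht).of_le (by norm_cast)) x).trans ?_
    exact mul_le_mul_of_nonneg_left (hM₂ t ht x hx) hκ0
  have hvol : volume (Metric.ball (0 : EuclideanSpace ℝ (Fin 3)) ρ) < ⊤ := measure_ball_lt_top
  -- gluing: total enstrophy, uniformly in `t`
  set W₁ : ℝ≥0∞ := ENNReal.ofReal ((κ * M₁) ^ 2) * volume (Metric.ball (0 : EuclideanSpace ℝ (Fin 3)) ρ) +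
    ENNReal.ofReal ((A * δ) ^ 2) with hW₁
  have hW₁top : W₁ < ⊤ :=
    ENNReal.add_lt_top.2 ⟨ENNReal.mul_lt_top ENNReal.ofReal_lt_top hvol, ENNReal.ofReal_lt_top⟩
  have hω : ∀ t ∈ Icc 0 T, ∫⁻ x, ‖FluidPDE.curl (u t) x‖ₑ ^ 2 ≤ W₁ := by
    intro t ht
    rw [← lintegral_add_compl _ (measurableSet_ball (x := (0 : EuclideanSpace ℝ (Fin 3))) (ε := ρ))]
    exact add_le_add (setLIntegral_ball_enorm_sq_le (hcurl_pt t ht)) (hext1 t ht)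
  -- gluing: `∫₀ᵀ ∫ |∇ω|²`
  set W₂ : ℝ≥0∞ := ENNReal.ofReal ((κ * M₂) ^ 2) * volume (Metric.ball (0 : EuclideanSpace ℝ (Fin 3)) ρ)
    with hW₂
  have hW₂top : W₂ < ⊤ := ENNReal.mul_lt_top ENNReal.ofReal_lt_top hvol
  have hdω : ∫⁻ t in Ioo 0 T, ∫⁻ x, ‖fderiv ℝ (FluidPDE.curl (u t)) x‖ₑ ^ 2 ≤
      W₂ * volume (Ioo (0 : ℝ) T) + ENNReal.ofReal ((A * δ) ^ 2) := by
    calc ∫⁻ t in Ioo 0 T, ∫⁻ x, ‖fderiv ℝ (FluidPDE.curl (u t)) x‖ₑ ^ 2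
        = ∫⁻ t in Ioo 0 T, ((∫⁻ x in Metric.ball (0 : EuclideanSpace ℝ (Fin 3)) ρ,
            ‖fderiv ℝ (FluidPDE.curl (u t)) x‖ₑ ^ 2) +
            ∫⁻ x in (Metric.ball (0 : EuclideanSpace ℝ (Fin 3)) ρ)ᶜ,
              ‖fderiv ℝ (FluidPDE.curl (u t)) x‖ₑ ^ 2) := by
          congr 1; funext t
          rw [lintegral_add_compl _ (measurableSet_ball (x := (0 : EuclideanSpace ℝ (Fin 3))) (ε := ρ))]
      _ ≤ ∫⁻ t in Ioo 0 T, (W₂ +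
            ∫⁻ x in (Metric.ball (0 : EuclideanSpace ℝ (Fin 3)) ρ)ᶜ,
              ‖fderiv ℝ (FluidPDE.curl (u t)) x‖ₑ ^ 2) := by
          refine setLIntegral_mono' measurableSet_Ioo fun t ht => ?_
          exact add_le_add (setLIntegral_ball_enorm_sq_le
            (hdcurl_pt t (Ioo_subset_Icc_self ht))) le_rfl
      _ = (∫⁻ _ in Ioo 0 T, W₂) +
            ∫⁻ t in Ioo 0 T, ∫⁻ x in (Metric.ball (0 : EuclideanSpace ℝ (Fin 3)) ρ)ᶜ,
              ‖fderiv ℝ (FluidPDE.curl (u t)) x‖ₑ ^ 2 :=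
          lintegral_add_left measurable_const _
      _ ≤ W₂ * volume (Ioo (0 : ℝ) T) + ENNReal.ofReal ((A * δ) ^ 2) := by
          rw [setLIntegral_const]
          exact add_le_add le_rfl hext2
  -- conclusion: `u ∈ X¹([0,T] × ℝ³)`
  refine ⟨fun j hj => ?_, ?_⟩
  · rcases Nat.le_one_iff_eq_zero_or_eq_one.1 hj with rfl | rfl
    · refine ⟨A₀.toNNReal, fun t ht => ?_⟩
      have : ∀ x, ‖iteratedFDeriv ℝ 0 (u t) x‖ₑ = ‖u t x‖ₑ := fun x => by
        rw [← ofReal_norm, ← ofReal_norm, norm_iteratedFDeriv_zero]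
      simp only [this]
      rw [ENNReal.coe_toNNReal hA₀top.ne]
      exact hA₀ t ht
    · refine ⟨((K : ℝ≥0∞) * W₁).toNNReal, fun t ht => ?_⟩
      rw [ENNReal.coe_toNNReal (ENNReal.mul_lt_top ENNReal.coe_lt_top hW₁top).ne]
      exact ((hK (hu t ht) (hsol.divFree t ht) (hL2 t ht)).1).trans
        (mul_le_mul_right (hω t ht) _)
  · calc ∫⁻ t in Ioo 0 T, ∫⁻ x, ‖iteratedFDeriv ℝ (1 + 1) (u t) x‖ₑ ^ 2
        ≤ ∫⁻ t in Ioo 0 T, (K : ℝ≥0∞) * ∫⁻ x, ‖fderiv ℝ (FluidPDE.curl (u t)) x‖ₑ ^ 2 :=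
          setLIntegral_mono' measurableSet_Ioo fun t ht =>
            (hK (hu t (Ioo_subset_Icc_self ht)) (hsol.divFree t (Ioo_subset_Icc_self ht))
              (hL2 t (Ioo_subset_Icc_self ht))).2
      _ = (K : ℝ≥0∞) * ∫⁻ t in Ioo 0 T, ∫⁻ x, ‖fderiv ℝ (FluidPDE.curl (u t)) x‖ₑ ^ 2 :=
          lintegral_const_mul' _ _ ENNReal.coe_ne_top
      _ < ⊤ := by
          refine ENNReal.mul_lt_top ENNReal.coe_lt_top (hdω.trans_lt ?_)
          exact ENNReal.add_lt_top.2
            ⟨ENNReal.mul_lt_top hW₂top (by simp), ENNReal.ofReal_lt_top⟩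

end BoundedEnstrophyUnit

/-! ## Cor. 11.1 WITH FORCE, a priori form, every viscosity `ν > 0` (Tao's rescaling, footnote 3) -/

section Rescaling

variable {ν T : ℝ} {f u : ℝ → EuclideanSpace ℝ (Fin 3) → EuclideanSpace ℝ (Fin 3)}
  {p : ℝ → EuclideanSpace ℝ (Fin 3) → ℝ}

/-- Finite dissipation is preserved by the rescaling `v(s,x) = ν⁻¹u(s/ν,x)`:
`∫₀^{νT}∫|∇v|² = ν⁻¹∫₀ᵀ∫|∇u|²` (smooth slices). [cite: Tao2011, footnote 3] -/
theorem dissipation_timeRescale_of_smooth (hν : 0 < ν) (hsm : ∀ t ∈ Icc 0 T, ContDiff ℝ ∞ (u t)) :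
    ∫⁻ s in Ioo 0 (ν * T), ∫⁻ x,
        ENNReal.ofReal (FluidPDE.frobeniusNormSq (fderiv ℝ (FluidPDE.timeRescale ν⁻¹ ν⁻¹ u s) x)) =
      ENNReal.ofReal ν⁻¹ *
        ∫⁻ t in Ioo 0 T, ∫⁻ x, ENNReal.ofReal (FluidPDE.frobeniusNormSq (fderiv ℝ (u t) x)) := by
  have hcongr : EqOn
      (fun s => ∫⁻ x,
        ENNReal.ofReal (FluidPDE.frobeniusNormSq (fderiv ℝ (FluidPDE.timeRescale ν⁻¹ ν⁻¹ u s) x)))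
      (fun s => ENNReal.ofReal (ν⁻¹ ^ 2) *
        ∫⁻ x, ENNReal.ofReal (FluidPDE.frobeniusNormSq (fderiv ℝ (u (ν⁻¹ * s)) x)))
      (Ioo 0 (ν * T)) := by
    intro s hs
    simp only
    rw [← lintegral_const_mul' _ _ ENNReal.ofReal_ne_top]
    refine lintegral_congr fun x => ?_
    have hd : DifferentiableAt ℝ (u (ν⁻¹ * s)) x :=
      ((hsm _ (FluidPDE.mapsTo_inv_mul_Icc hν (Ioo_subset_Icc_self hs))).differentiable (by simp)) x
    rw [FluidPDE.timeRescale_slice, fderiv_fun_const_smul hd, FluidPDE.frobeniusNormSq_const_smul,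
      ENNReal.ofReal_mul (sq_nonneg _)]
  rw [setLIntegral_congr_fun measurableSet_Ioo hcongr, lintegral_const_mul' _ _ ENNReal.ofReal_ne_top,
    FluidPDE.setLIntegral_Ioo_comp_inv_mul
      (fun t => ∫⁻ x, ENNReal.ofReal (FluidPDE.frobeniusNormSq (fderiv ℝ (u t) x))) hν T,
    ← mul_assoc, ofReal_inv_sq_mul_ofReal hν]

/-- The force budget of the rescaled force `g(s,x) = ν⁻²f(s/ν,x)`:
`∫₀^{νT}‖∇ × g(s)‖_{L²} ds = ν⁻² · ν ∫₀ᵀ‖∇ × f(t)‖_{L²} dt` (smooth slices). [cite: Tao2011, footnote 3] -/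
theorem forceBudget_timeRescale_of_smooth (hν : 0 < ν) (hfs : ∀ t ∈ Icc 0 T, ContDiff ℝ ∞ (f t)) :
    ∫⁻ s in Ioo 0 (ν * T), (∫⁻ x,
        ‖FluidPDE.curl (FluidPDE.timeRescale ν⁻¹ (ν⁻¹ ^ 2) f s) x‖ₑ ^ 2) ^ (1 / 2 : ℝ) =
      ENNReal.ofReal (ν⁻¹ ^ 2) * ENNReal.ofReal ν *
        ∫⁻ t in Ioo 0 T, (∫⁻ x, ‖FluidPDE.curl (f t) x‖ₑ ^ 2) ^ (1 / 2 : ℝ) := by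
  have hcongr : EqOn
      (fun s => (∫⁻ x, ‖FluidPDE.curl (FluidPDE.timeRescale ν⁻¹ (ν⁻¹ ^ 2) f s) x‖ₑ ^ 2) ^ (1 / 2 : ℝ))
      (fun s => ENNReal.ofReal (ν⁻¹ ^ 2) *
        (∫⁻ x, ‖FluidPDE.curl (f (ν⁻¹ * s)) x‖ₑ ^ 2) ^ (1 / 2 : ℝ)) (Ioo 0 (ν * T)) := by
    intro s hs
    simp only
    have hd : Differentiable ℝ (f (ν⁻¹ * s)) :=
      (hfs _ (FluidPDE.mapsTo_inv_mul_Icc hν (Ioo_subset_Icc_self hs))).differentiable (by simp)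
    rw [FluidPDE.timeRescale_slice, FluidPDE.curl_const_smul_eq hd, FluidPDE.lintegral_enorm_sq_const_smul,
      ENNReal.mul_rpow_of_nonneg _ _ (by norm_num : (0 : ℝ) ≤ 1 / 2)]
    congr 1
    rw [ENNReal.ofReal_rpow_of_nonneg (sq_nonneg _) (by norm_num : (0 : ℝ) ≤ 1 / 2),
      ← Real.sqrt_eq_rpow, Real.sqrt_sq (sq_nonneg _)]
  rw [setLIntegral_congr_fun measurableSet_Ioo hcongr, lintegral_const_mul' _ _ ENNReal.ofReal_ne_top,
    FluidPDE.setLIntegral_Ioo_comp_inv_mul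
      (fun t => (∫⁻ x, ‖FluidPDE.curl (f t) x‖ₑ ^ 2) ^ (1 / 2 : ℝ)) hν T, ← mul_assoc]

/-- **Tao 2011, Cor. 11.1 (Bounded enstrophy, arXiv Cor. 68) WITH FORCE — a priori form, every
viscosity `ν > 0`.** For a classical solution of the forced system with viscosity `ν > 0` on the
closed slab `[0,T] × ℝ³`, finite energy `sup_t ∫|u|² < ∞`, finite dissipation `∫₀ᵀ∫|∇u|² < ∞`
(Lemma 8.1), finite total speed `∫₀ᵀ‖u‖_{L^∞} < ∞` (Prop. 9.1), an `H¹` datum and a force with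
`‖∇ × f‖_{L¹_t L²_x} < ∞`: `u ∈ X¹([0,T] × ℝ³)`. From the unit-viscosity statement by the rescaling
`v(s,x) = ν⁻¹u(s/ν,x)`, `q = ν⁻²p(s/ν,x)`, `g = ν⁻²f(s/ν,x)` (footnote 3;
`IsClassicalNSSolutionOn.viscosityRescale`), which preserves every hypothesis, and
`memSobolevX_of_timeRescale`. [cite: Tao2011, Cor. 11.1 (arXiv Cor. 68, p. 36) + footnote 3] -/
theorem memSobolevX_one_forced_of_apriori (hY : tao2011_nonlinearEstimate)
    (hB : tao2011_sobolev_of_vorticity) (hν : 0 < ν) (hT : 0 < T)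
    (hsol : FluidPDE.IsClassicalNSSolutionOn (Icc 0 T) ν f u p)
    (hfe : ∃ A : ℝ≥0∞, A < ⊤ ∧ ∀ t ∈ Icc 0 T, ∫⁻ x, ‖u t x‖ₑ ^ 2 ≤ A)
    (hD : ∫⁻ t in Ioo 0 T, ∫⁻ x, ENNReal.ofReal (FluidPDE.frobeniusNormSq (fderiv ℝ (u t) x)) < ⊤)
    (hMt : ∫⁻ t in Ioo 0 T, eLpNorm (u t) ∞ volume < ⊤)
    (h₀ : ∫⁻ x, ‖iteratedFDeriv ℝ 1 (u 0) x‖ₑ ^ 2 < ⊤)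
    (hcf : ∫⁻ t in Ioo 0 T, (∫⁻ x, ‖FluidPDE.curl (f t) x‖ₑ ^ 2) ^ (1 / 2 : ℝ) < ⊤) :
    MemSobolevX 1 T u := by
  have hsm : ∀ t ∈ Icc 0 T, ContDiff ℝ ∞ (u t) := fun t ht => hsol.contDiff_velocity ht
  have hfsm : FluidPDE.IsSmoothSpaceTimeOn (Icc 0 T) f :=
    hsol.isSmoothSpaceTimeOn_force (uniqueDiffOn_Icc hT)
  have hfs : ∀ t ∈ Icc 0 T, ContDiff ℝ ∞ (f t) := fun t ht => hfsm.contDiff_slice ht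
  have hνT : 0 < ν * T := mul_pos hν hT
  -- the rescaled solution of the unit-viscosity forced system
  have hsol' := hsol.viscosityRescale hν hT
  -- finite energy
  have hfe' : ∃ A : ℝ≥0∞, A < ⊤ ∧ ∀ s ∈ Icc 0 (ν * T),
      ∫⁻ x, ‖FluidPDE.timeRescale ν⁻¹ ν⁻¹ u s x‖ₑ ^ 2 ≤ A := by
    obtain ⟨A, hAtop, hA⟩ := hfe
    refine ⟨ENNReal.ofReal (ν⁻¹ ^ 2) * A, ENNReal.mul_lt_top ENNReal.ofReal_lt_top hAtop,
      fun s hs => ?_⟩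
    rw [lintegral_timeRescale_sq]
    exact mul_le_mul_right (hA _ (FluidPDE.mapsTo_inv_mul_Icc hν hs)) _
  -- finite dissipation
  have hD' : ∫⁻ s in Ioo 0 (ν * T), ∫⁻ x, ENNReal.ofReal
      (FluidPDE.frobeniusNormSq (fderiv ℝ (FluidPDE.timeRescale ν⁻¹ ν⁻¹ u s) x)) < ⊤ := by
    rw [dissipation_timeRescale_of_smooth hν hsm]
    exact ENNReal.mul_lt_top ENNReal.ofReal_lt_top hD
  -- finite total speed
  have hMt' : ∫⁻ s in Ioo 0 (ν * T), eLpNorm (FluidPDE.timeRescale ν⁻¹ ν⁻¹ u s) ∞ volume < ⊤ := by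
    rw [setLIntegral_eLpNorm_timeRescale hν u T]
    exact hMt
  -- `H¹` datum
  have h₀' : ∫⁻ x, ‖iteratedFDeriv ℝ 1 (FluidPDE.timeRescale ν⁻¹ ν⁻¹ u 0) x‖ₑ ^ 2 < ⊤ := by
    rw [lintegral_iteratedFDeriv_timeRescale_sq hν hsm ⟨le_rfl, hνT.le⟩ 1, mul_zero]
    exact ENNReal.mul_lt_top ENNReal.ofReal_lt_top h₀
  -- force budget
  have hcf' : ∫⁻ s in Ioo 0 (ν * T), (∫⁻ x,
      ‖FluidPDE.curl (FluidPDE.timeRescale ν⁻¹ (ν⁻¹ ^ 2) f s) x‖ₑ ^ 2) ^ (1 / 2 : ℝ) < ⊤ := by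
    rw [forceBudget_timeRescale_of_smooth hν hfs]
    exact ENNReal.mul_lt_top (ENNReal.mul_lt_top ENNReal.ofReal_lt_top ENNReal.ofReal_lt_top) hcf
  exact memSobolevX_of_timeRescale hν hsm
    (memSobolevX_one_forced_unit_of_apriori hY hB hνT hsol' hfe' hD' hMt' h₀' hcf')

end Rescaling

end Literature.Analysis.FluidPDE

end
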